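import Summits.BirchSwinnertonDyer.BirchSwinnertonDyer.Theorems.ErratumRoadFiveShimuraKolyvaginOrderBoundInertShiftEnd
import HarnessLib

/-!
# Crux `ShimuraKolyvaginOrderBoundAtThreeSurj` (item stmt-BirchSwinnertonDyer-19899; K2@3 + KOLY residual) — the
# UNIT-INDEX slice at `p = 3` WITHOUT any Kodaira–Néron ∕ Tamagawa clause: `Ш(E/K)[3^∞] = 0` from the depth-`k`
# ring-class-rational carrier, via the level shift (local half: this seat, p477215; machine half: shim-p1, p480700–p482014)

Cell `bsd-stepL` (run/shared/lean/pub/bsd-stepL/), seat `bsd-stepL-shim3a` (prover g2), HELPER for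
`Summit.BirchSwinnertonDyer.BirchSwinnertonDyer.Theses.ClassRecordThree.ShimuraKolyvaginOrderBoundAtThreeSurj`
(`--supports stmt-BirchSwinnertonDyer-19899 --as helper`). The `p = 3` reading of shim-p1 g8's
`…InertShiftEnd.lean` (p482014: §2 `sha_primary_eq_zero_of_ringClassRationalPointsM_shift`, §3
`natCard_primaryComponent_sha_le_of_ringClassRationalPointsM_shift_of_poitouTate`), whose only use of `5 ≤ p` is
`p ≠ 2`: every ingredient — shim-p1's depth-`(M+k)` Čebotarev ∕ descent ∕ machine entry
(`sha_primary_eq_zero_at_of_pointsM_shift_of_reciprocityM_of_not_dvd_of_conductorNorm`), this seat's shift leaf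
`kolyvaginClass_mem_selmerLocalKer_of_ringClassRational_shift` (p477215 §6) and shim-p1's ℚ-side depth bound
`padicValNat_ordMinimalDiscriminant_le_of_split` — is stated for an odd prime. This SUPERSEDES the Kodaira–Néron
clause `hTam ∧ hKod` of this seat's `…SurjUnitIndex.lean` (p477925) for the `m₀ = 0` slice: the carrier is read
one notch deeper instead (depth `k₀ = 1 + Σ_{ℓ ∣ N} v₃(ord_ℓ Δ_min(E/ℚ))`, chosen inside).

* `sha_primary_eq_zero_of_ringClassRationalPointsM_shift_three` — `Ш(E/K)[3^∞] = 0` from `P ∉ 3E(K)`, the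
  depth-`k` carrier `hpointsRk` (binder VERBATIM from p482014 at `p = 3`) and (R)_M `hR` at 3; binders `hN`,
  `ρ̄_{E,3}` onto, `K` imaginary quadratic, `hin`, `hsp` VERBATIM from item 19899; NO clause on `E`.
* `natCard_primaryComponent_sha_le_of_ringClassRationalPointsM_shift_of_poitouTate_three` — the crux's conclusion
  `Nat.card (primaryComponent (W.baseChange K).sha 3) ≤ 3 ^ (2 * padicValNat 3 (zmultiples P).index)` on the slice
  `padicValNat 3 index = 0 ∧ 0 < index`, from `hpointsRk` + `hPT`.

## Honest framing

THEOREMS ONLY (no `def`, no named fact, no `sorry`; axioms standard). CONDITIONAL on (a) the depth-`k` carrier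
`hpointsRk` (Shimura CM points of `X_{N⁺,N⁻}` over `K[m]`: BD96 §2.3–2.6, Nekovář 2007 (4.8)–(4.13), CST14 —
printed; port in progress, shim-p1), (b) `hPT` (cite-only named fact), (c) `0 < index`; the ORDER form (3 ∣ index)
still carries the Kodaira–Néron clause (`…SurjOrderEnd.lean`, p483521) until the ORDER machine is run at depth
`M + k` (the kernel-form Čebotarev `ceb_kernel_of_dictionary_level` one level deeper + the order chain with
`Kol := depth M+k`; road memo §2 (γ₃′)). Item 19899 stays OPEN. BSD is not proved by any of this.

## References

[cite: GrossLMS1991, §1 Thm. 1.3 (2), Prop. 2.1 (2), §§3–8, §10] [cite: McCallumLMS1991, §1 Theorem, §3 Cor. 3.2, §§4–5, Lemma 4.6]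
[cite: BertoliniDarmon1996, §2.3–2.6, Prop. 2.6] [cite: Howard2004Duke, Thm. 3.2.2 (proof)]
[cite: MilneADT2006, Ch. I Prop. 3.8, Thm. 4.10(b)] [cite: SilvermanAEC2009, Prop. VII.5.4 (a), Thm. VII.6.1]
presearch: as for `…SurjUnitIndex.lean` (Gross Prop. 2.1 (2) on X₀(N); nothing at (3 ∣ N⁺, N⁻ > 1): D-AUDIT-19526c4
Table C; corpus + galaxy); tree `lean search 'RationalPointsM_shift_three'` → none.
-/

noncomputable section

open scoped Classical AddSubgroup
set_option linter.dupNamespace false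
namespace Summit.BirchSwinnertonDyer.BirchSwinnertonDyer.Theorems.ShimuraKolyvaginLocalShift

open WeierstrassCurve NumberField IsDedekindDomain Field Function
  Literature.NumberTheory.EllipticCurves Literature.NumberTheory.EllipticCurves.KolyvaginCocycle
  Literature.NumberTheory.EllipticCurves.KolyvaginDescent
  Literature.NumberTheory.EllipticCurves.RingClassField
  Literature.NumberTheory.GaloisRepresentations Literature.NumberTheory.NumberFields
  Literature.NumberTheory.GaloisCohomology
  Summit.BirchSwinnertonDyer.Rank1Residual.X11b
  Summit.BirchSwinnertonDyer.BirchSwinnertonDyer.Theorems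

variable {K : Type} [Field K] [NumberField K]

/-- **`Ш(E/K)[3^∞] = 0` from `P ∉ 3E(K)`, the depth-`k` RING-CLASS-RATIONAL Euler-system data at `3` and Kolyvagin
reciprocity at `3`, with NO Kodaira–Néron ∕ Tamagawa clause** — the `p = 3` twin of shim-p1's
`sha_primary_eq_zero_of_ringClassRationalPointsM_shift` (p482014 §2; statement and proof token-for-token at `p = 3`,
`5 ≤ p ↦ 3 ≠ 2`). Binders: the crux's `W` (globally minimal, conductor `N`), `ρ̄_{E,3}` onto, `K` imaginary
quadratic with `ι : K → ℂ`, `hin` ∕ `hsp` VERBATIM; `P` non-torsion with `3 ∤ P`; `hpointsRk` — for EVERY depth `k`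
the carrier with admissibility at `3^{M+k}` and, at square-free products of Kolyvagin primes of depth `M + k`,
invariance of `P_m` modulo `3^{M+k}` + Gross 5.4 (1) + McCallum 4.4; (R)_M `hR` at 3. Proof: shim-p1's depth-`k₀`
machine entry (`k₀ = 1 + Σ_{ℓ ∣ N} v₃(ord_ℓ Δ_min(E/ℚ))`) with clause (d) from this seat's shift leaf (p477215 §6).
[cite: GrossLMS1991, §1 Thm. 1.3 (2), Prop. 2.1 (2), §§3–8, §10] [cite: McCallumLMS1991, §1, §§4–5, Lemma 4.6]
[cite: BertoliniDarmon1996, §2.3–2.6, Prop. 2.6] [cite: Howard2004Duke, Thm. 3.2.2 (proof)] -/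
theorem sha_primary_eq_zero_of_ringClassRationalPointsM_shift_three
    (W : WeierstrassCurve ℚ) [W.IsElliptic] [W.IsGloballyMinimal] {N : ℕ} [NeZero N]
    (hN : W.conductorNorm ℤ = N) (hρ : W.HasSurjectiveModNGaloisRep 3) (hK : IsImaginaryQuadratic K) (ι : K →+* ℂ)
    {S : Finset ℕ}
    (hin : ∀ ℓ ∈ S, ℓ.Prime ∧ ℓ ∣ N ∧ ¬ ℓ ^ 2 ∣ N ∧
      ((Ideal.span {(ℓ : ℤ)}).primesOver (𝓞 K)).ncard = 1 ∧ ¬ (ℓ : ℤ) ∣ NumberField.discr K)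
    (hsp : ∀ ℓ : ℕ, ℓ.Prime → ℓ ∣ N → ℓ ∉ S → ((Ideal.span {(ℓ : ℤ)}).primesOver (𝓞 K)).ncard = 2)
    {P : (W.baseChange K).toAffine.Point} (hnt : ¬ IsOfFinAddOrder P)
    (hndvd : ∀ Q : (W.baseChange K).toAffine.Point, 3 • Q ≠ P)
    (hpointsRk : ∀ (k : ℕ) {M : ℕ} (_hM : 1 ≤ M)
      (hdiv : ∀ Q : geomPoints (W.baseChange K), ∃ R, ((3 ^ M : ℕ) : ℤ) • R = Q)
      (c : K ≃ₐ[ℚ] K) (_hc : c ≠ 1),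
      ∃ (ε : ℤ) (τ : AlgebraicClosure K ≃+* AlgebraicClosure K) (hτ : IsLiftOfAut c τ)
        (A : ℕ → AddSubgroup (geomPoints (W.baseChange K)))
        (hA : ∀ m, KolyvaginCocycle.IsAdmissible (Field.absoluteGaloisGroup K) (A m)
          ((3 ^ M : ℕ) : ℤ))
        (emb : ∀ m : ℕ, ringClassField K ι m →ₐ[K] AlgebraicClosure K)
        (Pt : ℕ → geomPoints (W.baseChange K))
        (hPt : ∀ m, Pt m ∈
          KolyvaginCocycle.invPoints (Field.absoluteGaloisGroup K) (A m) ((3 ^ M : ℕ) : ℤ)),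
        (ε = 1 ∨ ε = -1) ∧
        IsOfFinAddOrder (Affine.Point.map (W' := W) (c : K →ₐ[ℚ] K) P - ε • P) ∧
        (∀ m, ∀ a ∈ A m, hτ.pointsMap W a ∈ A m) ∧
        Pt 1 = toGeomPoints (W.baseChange K) P ∧
        (∀ m, m ≠ 0 → ∀ a ∈ A m, ∀ Φ : Field.absoluteGaloisGroup K,
          (∀ x : ringClassField K ι m, Φ • emb m x = emb m x) → Φ • a = a) ∧
        (∀ m, KolyvaginCocycle.IsAdmissible (Field.absoluteGaloisGroup K) (A m)
          ((3 ^ (M + k) : ℕ) : ℤ)) ∧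
        (∀ m : ℕ, Squarefree m →
          (∀ q ∈ m.primeFactors, IsKolyvaginPrime N W K 3 q ∧ FrobEqFrobInfty W K (3 ^ (M + k)) q) →
          Pt m ∈ KolyvaginCocycle.invPoints (Field.absoluteGaloisGroup K) (A m)
            ((3 ^ (M + k) : ℕ) : ℤ) ∧
          (∃ B ∈ A m, hτ.pointsMap W (Pt m) =
            (ε * (-1) ^ m.primeFactors.card) • Pt m + ((3 ^ M : ℕ) : ℤ) • B) ∧
          (∀ ℓ : ℕ, ℓ.Prime → ℓ ∣ m → ∀ v : HeightOneSpectrum (𝓞 K), (ℓ : 𝓞 K) ∈ v.asIdeal →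
            ∀ a : ℕ, (((3 : ℤ) ^ a) •
                kolyvaginClass (W.baseChange K) _ hdiv (hA m) (Pt m) (hPt m) ∈
                selmerLocalKer (W.baseChange K) (v.adicCompletion K) ((3 ^ M : ℕ) : ℤ) ↔
              ((3 : ℤ) ^ a) • kolyvaginClass (W.baseChange K) _ hdiv (hA (m / ℓ)) (Pt (m / ℓ))
                  (hPt (m / ℓ)) ∈
                (W.baseChange K).torsionLocalKer (v.adicCompletion K) ((3 ^ M : ℕ) : ℤ)))))
    (hR : ∀ {M : ℕ} (_hM : 1 ≤ M) {ℓ : ℕ} (hℓ : IsKolyvaginPrime N W K 3 ℓ),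
      FrobEqFrobInfty W K (3 ^ M) ℓ →
      ∃ (A : Type) (_ : AddCommGroup A)
        (e : geomTorsion (W.baseChange K) ((3 ^ M : ℕ) : ℤ) →+
          geomTorsion (W.baseChange K) ((3 ^ M : ℕ) : ℤ) →+ A),
        (∀ x, e x x = 0) ∧ (∀ x, (∀ y, e x y = 0) → x = 0) ∧
        ∀ s ∈ selmerGroup (W.baseChange K) ((3 ^ M : ℕ) : ℤ),
          ∀ c' : galH1Torsion (W.baseChange K) ((3 ^ M : ℕ) : ℤ),
          (∀ v : HeightOneSpectrum (𝓞 K), (ℓ : 𝓞 K) ∉ v.asIdeal →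
            c' ∈ selmerLocalKer (W.baseChange K) (v.adicCompletion K) ((3 ^ M : ℕ) : ℤ)) →
          (∀ w : InfinitePlace K,
            c' ∈ selmerLocalKer (W.baseChange K) w.Completion ((3 ^ M : ℕ) : ℤ)) →
          ∀ 𝔔 ∈ hℓ.place.primesAbove, ∀ F : Field.absoluteGaloisGroup K,
            IsArithFrobAt (𝓞 K) F 𝔔 →
            F ∈ torsionFixing (W.baseChange K) ((3 ^ M : ℕ) : ℤ) →
            ∀ σ ∈ 𝔔.inertia (Field.absoluteGaloisGroup K),
            e (h1Eval (W.baseChange K) ((3 ^ M : ℕ) : ℤ) s F)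
              (h1Eval (W.baseChange K) ((3 ^ M : ℕ) : ℤ) c' σ) = 0) :
    ∀ d : (W.baseChange K).sha, (∃ j : ℕ, 3 ^ j • d = 0) → d = 0 := by
  haveI : (W.baseChange K).IsElliptic := inferInstanceAs (W.map (algebraMap ℚ K)).IsElliptic
  have hp : (3 : ℕ).Prime := Nat.prime_three
  have hp2 : (3 : ℕ) ≠ 2 := by decide
  -- the depth `k₀` absorbing the `3`-parts of all Kodaira–Néron exponents on the locus
  set k₀ : ℕ := 1 + ∑ q ∈ N.primeFactors, padicValNat 3 (padicValInt q W.minimalDiscriminantInt) with hk₀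
  have hk1 : 1 ≤ k₀ := Nat.le_add_right 1 _
  have hkm : ∀ w : HeightOneSpectrum (𝓞 K), (W.baseChange K).HasMultiplicativeReductionAt w →
      ((Rat.HeightOneSpectrum.primesEquiv (w.under (𝓞 ℚ)) : ℕ)) ∉ S →
      padicValNat 3 ((W.baseChange K).ordMinimalDiscriminant w) ≤ k₀ := fun w hmw hℓS ↦
    padicValNat_ordMinimalDiscriminant_le_of_split hK W hN 3 hsp w hmw hℓS
  refine sha_primary_eq_zero_at_of_pointsM_shift_of_reciprocityM_of_not_dvd_of_conductorNorm W hN hK hnt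
    hp hp2 hρ k₀ hndvd ?_ hR
  intro M hM hdiv c hc
  obtain ⟨ε, τ, hτ, A, hA, emb, Pt, hPt, hε, h53, hAτ, hPt1, hrat, hAk, hm'⟩ := hpointsRk k₀ hM hdiv c hc
  refine ⟨ε, τ, hτ, A, hA, Pt, hPt, hε, h53, hAτ, hPt1, fun m hm hk ↦
    ⟨(hm' m hm hk).2.1, ?_, (hm' m hm hk).2.2⟩⟩
  intro v hv
  have hm0 : m ≠ 0 := Squarefree.ne_zero hm
  exact kolyvaginClass_mem_selmerLocalKer_of_ringClassRational_shift hK ι hm0 (emb m) W hp hp2 hin hk1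
    hkm (fun q hq ↦ (hk q hq).1.2.1) (hA m) (hAk m) (hrat m hm0) (hPt m) ((hm' m hm hk).1) v hv


/-- **The crux's conclusion on its UNIT-INDEX slice at `3` with NO Kodaira–Néron clause: `#Ш(E/K)[3^∞] ≤
3^(2·ord₃[E(K):ℤP])` (here `= 1`) from the depth-`k` carrier and the Poitou–Tate named fact** — the `p = 3` twin
of shim-p1's `natCard_primaryComponent_sha_le_of_ringClassRationalPointsM_shift_of_poitouTate` (p482014 §3).
Binders: the crux's + `ι` + `P` non-torsion with `padicValNat 3 [E(K):ℤP] = 0` and `0 < [E(K):ℤP]` + `hpointsRk`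
+ `hPT` (cite-only ⇒ CONDITIONAL). HONEST: item 19899 stays OPEN; gap on this slice = {carrier, `hPT`, `0 < index`}.
[cite: GrossLMS1991, Prop. 2.1 (2)] [cite: McCallumLMS1991, §1 Theorem (Kolyvagin), Lemma 5.1]
[cite: MilneADT2006, Ch. I Thm. 4.10(b)] -/
theorem natCard_primaryComponent_sha_le_of_ringClassRationalPointsM_shift_of_poitouTate_three
    (hPT : poitouTate_sum_localTatePairing_eq_zero K)
    (W : WeierstrassCurve ℚ) [W.IsElliptic] [W.IsGloballyMinimal] {N : ℕ} [NeZero N]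
    (hN : W.conductorNorm ℤ = N) (hρ : W.HasSurjectiveModNGaloisRep 3) (hK : IsImaginaryQuadratic K) (ι : K →+* ℂ)
    {S : Finset ℕ}
    (hin : ∀ ℓ ∈ S, ℓ.Prime ∧ ℓ ∣ N ∧ ¬ ℓ ^ 2 ∣ N ∧
      ((Ideal.span {(ℓ : ℤ)}).primesOver (𝓞 K)).ncard = 1 ∧ ¬ (ℓ : ℤ) ∣ NumberField.discr K)
    (hsp : ∀ ℓ : ℕ, ℓ.Prime → ℓ ∣ N → ℓ ∉ S → ((Ideal.span {(ℓ : ℤ)}).primesOver (𝓞 K)).ncard = 2)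
    {P : (W.baseChange K).toAffine.Point} (hnt : ¬ IsOfFinAddOrder P)
    (hidx0 : 0 < (AddSubgroup.zmultiples P).index)
    (hidx : padicValNat 3 (AddSubgroup.zmultiples P).index = 0)
    (hpointsRk : ∀ (k : ℕ) {M : ℕ} (_hM : 1 ≤ M)
      (hdiv : ∀ Q : geomPoints (W.baseChange K), ∃ R, ((3 ^ M : ℕ) : ℤ) • R = Q)
      (c : K ≃ₐ[ℚ] K) (_hc : c ≠ 1),
      ∃ (ε : ℤ) (τ : AlgebraicClosure K ≃+* AlgebraicClosure K) (hτ : IsLiftOfAut c τ)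
        (A : ℕ → AddSubgroup (geomPoints (W.baseChange K)))
        (hA : ∀ m, KolyvaginCocycle.IsAdmissible (Field.absoluteGaloisGroup K) (A m)
          ((3 ^ M : ℕ) : ℤ))
        (emb : ∀ m : ℕ, ringClassField K ι m →ₐ[K] AlgebraicClosure K)
        (Pt : ℕ → geomPoints (W.baseChange K))
        (hPt : ∀ m, Pt m ∈
          KolyvaginCocycle.invPoints (Field.absoluteGaloisGroup K) (A m) ((3 ^ M : ℕ) : ℤ)),
        (ε = 1 ∨ ε = -1) ∧
        IsOfFinAddOrder (Affine.Point.map (W' := W) (c : K →ₐ[ℚ] K) P - ε • P) ∧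
        (∀ m, ∀ a ∈ A m, hτ.pointsMap W a ∈ A m) ∧
        Pt 1 = toGeomPoints (W.baseChange K) P ∧
        (∀ m, m ≠ 0 → ∀ a ∈ A m, ∀ Φ : Field.absoluteGaloisGroup K,
          (∀ x : ringClassField K ι m, Φ • emb m x = emb m x) → Φ • a = a) ∧
        (∀ m, KolyvaginCocycle.IsAdmissible (Field.absoluteGaloisGroup K) (A m)
          ((3 ^ (M + k) : ℕ) : ℤ)) ∧
        (∀ m : ℕ, Squarefree m →
          (∀ q ∈ m.primeFactors, IsKolyvaginPrime N W K 3 q ∧ FrobEqFrobInfty W K (3 ^ (M + k)) q) →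
          Pt m ∈ KolyvaginCocycle.invPoints (Field.absoluteGaloisGroup K) (A m)
            ((3 ^ (M + k) : ℕ) : ℤ) ∧
          (∃ B ∈ A m, hτ.pointsMap W (Pt m) =
            (ε * (-1) ^ m.primeFactors.card) • Pt m + ((3 ^ M : ℕ) : ℤ) • B) ∧
          (∀ ℓ : ℕ, ℓ.Prime → ℓ ∣ m → ∀ v : HeightOneSpectrum (𝓞 K), (ℓ : 𝓞 K) ∈ v.asIdeal →
            ∀ a : ℕ, (((3 : ℤ) ^ a) •
                kolyvaginClass (W.baseChange K) _ hdiv (hA m) (Pt m) (hPt m) ∈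
                selmerLocalKer (W.baseChange K) (v.adicCompletion K) ((3 ^ M : ℕ) : ℤ) ↔
              ((3 : ℤ) ^ a) • kolyvaginClass (W.baseChange K) _ hdiv (hA (m / ℓ)) (Pt (m / ℓ))
                  (hPt (m / ℓ)) ∈
                (W.baseChange K).torsionLocalKer (v.adicCompletion K) ((3 ^ M : ℕ) : ℤ))))) :
    Nat.card (AddCommGroup.primaryComponent (W.baseChange K).sha 3) ≤
      3 ^ (2 * padicValNat 3 (AddSubgroup.zmultiples P).index) := by
  have hp : (3 : ℕ).Prime := Nat.prime_three
  have hndvd : ∀ Q : (W.baseChange K).toAffine.Point, 3 • Q ≠ P :=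
    nsmul_ne_of_padicValNat_index_eq_zero hnt hp hidx0 hidx
  have h0 := sha_primary_eq_zero_of_ringClassRationalPointsM_shift_three W hN hρ hK ι hin hsp hnt hndvd
    hpointsRk (@fun _ hM _ hℓ _ ↦ kolyvaginReciprocityM_of_poitouTate_of_conductorNorm W hN hPT hp hM hℓ)
  have hbot : AddCommGroup.primaryComponent (W.baseChange K).sha 3 = ⊥ := by
    refine (AddSubgroup.eq_bot_iff_forall _).mpr fun x hx ↦ ?_
    obtain ⟨n, hn⟩ := (AddCommGroup.mem_primaryComponent).1 hx
    exact h0 x ⟨n, hn⟩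
  rw [hbot, AddSubgroup.card_bot, hidx, mul_zero, pow_zero]

end Summit.BirchSwinnertonDyer.BirchSwinnertonDyer.Theorems.ShimuraKolyvaginLocalShift
end
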